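import Mathlib
import HarnessLib
import Summits.HubbardSuperconductivity.HubbardSuperconductivity.Theorems.KLProgrammeH10TwoPointLimitKlAnisoLastLegCount
import Summits.HubbardSuperconductivity.HubbardSuperconductivity.Theorems.KLProgrammeH10TwoPointLimitFrameLastLegCountThinUniform

/-!
# Route `KLProgramme` — K3 engine child `KLRegimeEngineV17F2` (stmt-HubbardSuperconductivity-20437), stub (b) (ℓ)/(I2): THE LAST LEG OF AN ENGINE LABEL TUPLE IS
# DETERMINED — the m-UNIFORM forms of `card_lastLeg_bgmSectorSet_klAniso_le_frame[OK]` (located item «(I2)-CONST-UNIFORM»; cell gate-hubbard-kl, seat p4 g17)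

`card_lastLeg_bgmSectorSet_klAniso_le_frame` (p4 g11) is typed `∀ m, ∃ κ D, …`; its proof takes `κ = min κ₁ (min (Dtmin/2) (m₀/2))` with the thin-shell
threshold `κ₁` of `lastLegCount_thin_frame` — radius-free by `lastLegCount_thin_frame_uniform` — and `D = 6(2m+3)²·D₁(m·Cc) + 2π/w₀` with `D₁` affine in the
target radius.  Re-exposed with the honest quantifier order (same proof): the frame threshold is fixed BEFORE the number of legs and the count is CUBIC in it —
what the kit `towerBorn_le_law_tracks` needs (degrees up to the volume cap, constants of at most geometric growth, thresholds m-free).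

* **`card_lastLeg_bgmSectorSet_klAniso_le_frame_uniform`** — `∃ κ > 0, ∃ D₀ > 0, ∀ m, ∀ frames (4A ≤ κ) …: #{ω : update ρ ℓ ((ω,s),c) ∈ bgmSectorSet …} ≤ D₀·(m+2)³`;
* **`card_lastLeg_bgmSectorSet_klAniso_le_frameOK_uniform`** — in the KL regime: `∃ D₀ > 0, ∀ R (Gfr ≥ 0), ∃ c₃ U₀ > 0` (m-FREE), `∀ m, …, ≤ D₀·(m+2)³`.
Everything is PROVED; no definitions, no named facts; nothing about the model is asserted.
References: BGM 2006 §2.8 (2.83), (2.89), App. A3 [cite: BenfattoGiulianiMastropietro2006].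
-/

noncomputable section

namespace Summit.HubbardSuperconductivity.HubbardSuperconductivity.Theorems.PerturbedFermiCurve

set_option linter.dupNamespace false -- summit = problem name (single-conjunct summit), D-0017

open Classical
open Real Set Finset
open Literature.MathematicalPhysics.QuantumLattice Literature.MathematicalPhysics.QuantumLattice.BandSectorCounting
open Literature.Probability.LatticeModels
open Summit.HubbardSuperconductivity.HubbardSuperconductivity.Theorems.DispersionFlow
open Summit.HubbardSuperconductivity.HubbardSuperconductivity.Theorems.KLRegimeSplit
open Summit.HubbardSuperconductivity.HubbardSuperconductivity.Theorems.KLProgrammeLegKernels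

/-- **THE LAST LEG OF AN ENGINE LABEL TUPLE IS DETERMINED — m-UNIFORM FORM**: for every level window `[μ₁, μ₂] ⊂ (-4, 0)` there are `κ > 0` and `D₀ > 0`
such that for EVERY number of legs `m + 1`, every frame `K` of `C²` size `A` with `4A ≤ κ`, every `μ ∈ [μ₁, μ₂]`, `L ≥ 1`, `M`, `β`, `n`, `ρ`, `ℓ`, `(s, c)`:
`#{ω : update ρ ℓ ((ω, s), c) ∈ bgmSectorSet L M (klAnisoFamily L M β μ K klE0 n) (m + 1)} ≤ D₀·(m + 2)³`.
[cite: BenfattoGiulianiMastropietro2006, §2.8 (2.83), (2.89), App. A3] -/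
theorem card_lastLeg_bgmSectorSet_klAniso_le_frame_uniform :
    ∀ μ₁ μ₂ : ℝ, -4 < μ₁ → μ₁ ≤ μ₂ → μ₂ < 0 → ∃ κ : ℝ, 0 < κ ∧ ∃ D₀ : ℝ, 0 < D₀ ∧ ∀ m : ℕ,
      ∀ (K : TrigPolyC4v) (A : ℝ), (∀ p : Momentum, ∀ j ≤ 2, ‖iteratedFDeriv ℝ j (frameShift K) p‖ ≤ A) → 4 * A ≤ κ →
      ∀ μ ∈ Set.Icc μ₁ μ₂, ∀ (L M : ℕ) [NeZero L] (β : ℝ) (n : ℕ) (ρ : Fin (m + 1) → SectorLeg (sectorCount n))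
        (ℓ : Fin (m + 1)) (s c : Fin 2),
      ((((Finset.univ : Finset (Fin (sectorCount n))).filter (fun ω : Fin (sectorCount n) =>
        Function.update ρ ℓ ((ω, s), c) ∈ bgmSectorSet L M (klAnisoFamily L M β μ K klE0 n) (m + 1))).card : ℕ) : ℝ) ≤
        D₀ * ((m : ℝ) + 2) ^ 3 := by
  intro μ₁ μ₂ hμ₁ h12 hμ₂
  have ha : -4 < (μ₁ - 4) / 2 := by linarith
  have hab : (μ₁ - 4) / 2 ≤ μ₂ / 2 := by linarith
  have hb : μ₂ / 2 < 0 := by linarith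
  obtain ⟨B, -⟩ : ∃ B : BandBounds ((μ₁ - 4) / 2) (μ₂ / 2), B = bandBounds ha hab hb := ⟨_, rfl⟩
  obtain ⟨m₀, hm₀def⟩ : ∃ m₀ : ℝ, m₀ = min (μ₁ - (μ₁ - 4) / 2) (μ₂ / 2 - μ₂) := ⟨_, rfl⟩
  have hm₀ : 0 < m₀ := by rw [hm₀def]; exact lt_min (by linarith) (by linarith)
  have hm1 : m₀ ≤ μ₁ - (μ₁ - 4) / 2 := by rw [hm₀def]; exact min_le_left _ _
  have hm2 : m₀ ≤ μ₂ / 2 - μ₂ := by rw [hm₀def]; exact min_le_right _ _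
  have hDt := B.Dtmin_pos; have hs := B.smax_pos; have hπ := Real.pi_pos
  have he0 : (0 : ℝ) < klE0 := by norm_num [klE0]
  -- the cell constant of the other legs and §1 for the last leg
  obtain ⟨Cc, hCc⟩ : ∃ Cc : ℝ, Cc = 2 * (klE0 / π + B.smax * B.Dtmin * (3 / 4)) / B.Dtmin := ⟨_, rfl⟩
  have hCc0 : 0 ≤ Cc := by rw [hCc]; positivity
  obtain ⟨κ₁, hκ₁, D₀', hD₀', huni⟩ :=
    lastLegCount_thin_frame_uniform μ₁ μ₂ (klE0 / π ^ 2) hμ₁ h12 hμ₂ (by positivity)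
  obtain ⟨κ, hκdef⟩ : ∃ κ : ℝ, κ = min κ₁ (min (B.Dtmin / 2) (m₀ / 2)) := ⟨_, rfl⟩
  have hκ0 : 0 < κ := by rw [hκdef]; exact lt_min hκ₁ (lt_min (by positivity) (by positivity))
  have hκκ₁ : κ ≤ κ₁ := by rw [hκdef]; exact min_le_left _ _
  have hκD : κ ≤ B.Dtmin / 2 := by rw [hκdef]; exact (min_le_right _ _).trans (min_le_left _ _)
  have hκm : κ ≤ m₀ / 2 := by rw [hκdef]; exact (min_le_right _ _).trans (min_le_right _ _)
  obtain ⟨w₀, hw₀⟩ : ∃ w₀ : ℝ, w₀ = min 1 (m₀ / 4) := ⟨_, rfl⟩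
  have hw₀pos : 0 < w₀ := by rw [hw₀]; exact lt_min one_pos (by positivity)
  refine ⟨κ, hκ0, 24 * D₀' * (Cc + 1) + 2 * π / w₀, by positivity, ?_⟩
  intro m
  obtain ⟨D₁, hD₁def⟩ : ∃ D₁ : ℝ, D₁ = D₀' * ((m : ℝ) * Cc + 1) := ⟨_, rfl⟩
  have hD₁ : 0 < D₁ := by rw [hD₁def]; positivity
  have hlast := fun (K : TrigPolyC4v) (A : ℝ) (hA : ∀ p : Momentum, ∀ j ≤ 2, ‖iteratedFDeriv ℝ j (frameShift K) p‖ ≤ A) (hAκ : 4 * A ≤ κ₁)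
      (μ : ℝ) (hμ : μ ∈ Set.Icc μ₁ μ₂) (n : ℕ) (q : Fin 2 → ℝ) =>
    (huni ((m : ℝ) * Cc) (by positivity) K A hA hAκ μ hμ n q).trans_eq hD₁def.symm
  -- the polynomial bound of the original constant
  have hpoly : 6 * (2 * (m : ℝ) + 3) ^ 2 * D₁ + 2 * π / w₀ ≤ (24 * D₀' * (Cc + 1) + 2 * π / w₀) * ((m : ℝ) + 2) ^ 3 := by
    have hm0 : (0 : ℝ) ≤ m := Nat.cast_nonneg m
    have h1 : (2 * (m : ℝ) + 3) ^ 2 ≤ 4 * ((m : ℝ) + 2) ^ 2 := by nlinarith only [hm0]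
    have h2 : (m : ℝ) * Cc + 1 ≤ (Cc + 1) * ((m : ℝ) + 2) := by nlinarith only [hm0, hCc0]
    have h3 : D₁ ≤ D₀' * (Cc + 1) * ((m : ℝ) + 2) := by rw [hD₁def, mul_assoc]; exact mul_le_mul_of_nonneg_left h2 hD₀'.le
    have h4 : 6 * (2 * (m : ℝ) + 3) ^ 2 * D₁ ≤ 24 * D₀' * (Cc + 1) * ((m : ℝ) + 2) ^ 3 := by
      calc 6 * (2 * (m : ℝ) + 3) ^ 2 * D₁ ≤ 6 * (4 * ((m : ℝ) + 2) ^ 2) * (D₀' * (Cc + 1) * ((m : ℝ) + 2)) := by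
            gcongr
        _ = 24 * D₀' * (Cc + 1) * ((m : ℝ) + 2) ^ 3 := by ring
    have h5 : 2 * π / w₀ ≤ 2 * π / w₀ * ((m : ℝ) + 2) ^ 3 := by
      have h8 : (1 : ℝ) ≤ ((m : ℝ) + 2) ^ 3 := one_le_pow₀ (by linarith)
      have : (0 : ℝ) ≤ 2 * π / w₀ := by positivity
      nlinarith only [this, h8]
    nlinarith only [h4, h5]
  intro K A hA hAκ μ hμ L M _ β n ρ ℓ s c
  refine le_trans ?_ hpoly
  have hA0 : 0 ≤ A := le_trans (norm_nonneg _) (hA 0 0 (by norm_num))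
  have hA2 : 2 * A < B.Dtmin := by linarith
  have hAm : A ≤ m₀ / 8 := by linarith
  have hAκ₁ : 4 * A ≤ κ₁ := hAκ.trans hκκ₁
  have hNpos : 0 < sectorCount n := sectorCount_pos n
  have hwpos : 0 < sectorWidth n := sectorWidth_pos n
  have hwπ : sectorWidth n ≤ π := sectorWidth_le_pi n
  have hNw : (sectorCount n : ℝ) * sectorWidth n = 2 * π := sectorCount_mul_sectorWidth n
  -- the set to be counted, made opaque
  obtain ⟨S, hS⟩ : ∃ S : Finset (Fin (sectorCount n)), S = (Finset.univ : Finset (Fin (sectorCount n))).filter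
      (fun ω : Fin (sectorCount n) => Function.update ρ ℓ ((ω, s), c) ∈ bgmSectorSet L M (klAnisoFamily L M β μ K klE0 n) (m + 1)) :=
    ⟨_, rfl⟩
  rw [← hS]
  have htriv : ((S.card : ℕ) : ℝ) ≤ 2 * π / sectorWidth n := by
    have h1 : S.card ≤ (Finset.univ : Finset (Fin (sectorCount n))).card := by rw [hS]; exact Finset.card_filter_le _ _
    rw [Finset.card_univ, Fintype.card_fin] at h1
    rw [le_div_iff₀ hwpos, ← hNw]
    exact mul_le_mul_of_nonneg_right (by exact_mod_cast h1) hwpos.le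
  by_cases hwle : sectorWidth n ≤ w₀
  · -- the main case: the supports of the other legs are cells in the level range
    have hw1 : sectorWidth n ≤ 1 := hwle.trans (by rw [hw₀]; exact min_le_left _ _)
    have hwm : sectorWidth n ≤ m₀ / 4 := hwle.trans (by rw [hw₀]; exact min_le_right _ _)
    have hkl : klScale klE0 n ≤ klE0 / π * sectorWidth n := by
      rw [klScale_eq_mul_sectorWidth_sq, div_mul_eq_mul_div, div_mul_eq_mul_div,
        div_le_div_iff₀ (by positivity) (by positivity)]
      calc klE0 * sectorWidth n ^ 2 * π = (klE0 * sectorWidth n * π) * sectorWidth n := by ring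
        _ ≤ (klE0 * sectorWidth n * π) * π := mul_le_mul_of_nonneg_left hwπ (by positivity)
        _ = klE0 * sectorWidth n * π ^ 2 := by ring
    have hklw : klScale klE0 n ≤ sectorWidth n := by
      refine hkl.trans ?_
      have : klE0 / π ≤ 1 := by
        rw [div_le_one hπ]; have := Real.pi_gt_three; norm_num [klE0]; linarith
      nlinarith [this, hwpos]
    have hlo : (μ₁ - 4) / 2 ≤ μ - A - klScale klE0 n := by linarith [hμ.1]
    have hhi : μ + A + klScale klE0 n ≤ μ₂ / 2 := by linarith [hμ.2]
    -- the cell radius of the other legs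
    obtain ⟨rc, hrc⟩ : ∃ rc : ℝ, rc = (klScale klE0 n + B.smax * B.Dtmin * (3 * sectorWidth n / 4)) / (B.Dtmin - 2 * A) := ⟨_, rfl⟩
    have hden : B.Dtmin / 2 ≤ B.Dtmin - 2 * A := by linarith
    have hden0 : 0 < B.Dtmin - 2 * A := by linarith
    have hrcw : rc ≤ Cc * sectorWidth n := by
      have hnum : klScale klE0 n + B.smax * B.Dtmin * (3 * sectorWidth n / 4) ≤
          (klE0 / π + B.smax * B.Dtmin * (3 / 4)) * sectorWidth n := by rw [add_mul]; linarith [hkl]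
      have hnum0 : 0 ≤ (klE0 / π + B.smax * B.Dtmin * (3 / 4)) * sectorWidth n := by positivity
      have h1 : rc ≤ (klE0 / π + B.smax * B.Dtmin * (3 / 4)) * sectorWidth n / (B.Dtmin / 2) := by
        rw [hrc]; exact div_le_div₀ hnum0 hnum (by positivity) hden
      have e : (klE0 / π + B.smax * B.Dtmin * (3 / 4)) * sectorWidth n / (B.Dtmin / 2) = Cc * sectorWidth n := by
        rw [hCc, div_eq_iff (by positivity)]
        field_simp
      linarith [h1, e]
    -- the signed Fermi points of the other legs and the targets
    obtain ⟨P, hP⟩ : ∃ P : Fin (m + 1) → Fin 2 → ℝ, ∀ i j, P i j =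
        if (ρ i).2 = 0 then klFermiPoint μ K (sectorCenter n (ρ i).1.1) j else -klFermiPoint μ K (sectorCenter n (ρ i).1.1) j :=
      ⟨fun i j => _, fun _ _ => rfl⟩
    -- reciprocal vectors `|G_j| ≤ m + 1`, parametrised by `Fin (2m+3) × Fin (2m+3)`
    obtain ⟨Gof, hGofdef⟩ : ∃ Gof : Fin (2 * m + 3) × Fin (2 * m + 3) → Fin 2 → ℤ, ∀ g i,
        Gof g i = if i = 0 then ((g.1 : ℕ) : ℤ) - (m + 1) else ((g.2 : ℕ) : ℤ) - (m + 1) := ⟨fun g i => _, fun _ _ => rfl⟩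
    obtain ⟨tg, htg⟩ : ∃ tg : Fin (2 * m + 3) × Fin (2 * m + 3) → Fin 2 → ℝ, ∀ g j,
        tg g j = 2 * π * (Gof g j : ℝ) - ∑ i ∈ Finset.univ.erase ℓ, P i j := ⟨fun g j => _, fun _ _ => rfl⟩
    -- the six candidate sharp indices of the last leg
    obtain ⟨sh, hshdef⟩ : ∃ sh : Fin 2 × Fin 3 → Fin (sectorCount n) → Fin (sectorCount n),
        ∀ ed ω, (sh ed ω : ℕ) = ((ω : ℕ) + (ed.1 : ℕ) * 2 ^ n + (ed.2 : ℕ) + (sectorCount n - 1)) % sectorCount n :=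
      ⟨fun ed ω => ⟨((ω : ℕ) + (ed.1 : ℕ) * 2 ^ n + (ed.2 : ℕ) + (sectorCount n - 1)) % sectorCount n, Nat.mod_lt _ hNpos⟩,
        fun _ _ => rfl⟩
    have hsh_inj : ∀ (ed : Fin 2 × Fin 3) (ω ω' : Fin (sectorCount n)), sh ed ω = sh ed ω' → ω = ω' := by
      intro ed ω ω' h1
      have h1' : ((ω : ℕ) + ((ed.1 : ℕ) * 2 ^ n + (ed.2 : ℕ) + (sectorCount n - 1))) % sectorCount n =
          ((ω' : ℕ) + ((ed.1 : ℕ) * 2 ^ n + (ed.2 : ℕ) + (sectorCount n - 1))) % sectorCount n := by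
        have := congrArg Fin.val h1
        rw [hshdef, hshdef] at this
        simpa only [add_assoc] using this
      have hmod : (ω : ℕ) ≡ (ω' : ℕ) [MOD sectorCount n] := Nat.ModEq.add_right_cancel' _ h1'
      exact Fin.ext (Nat.ModEq.eq_of_lt_of_lt hmod ω.isLt ω'.isLt)
    -- the last-leg sets of §1, one per target
    obtain ⟨T, hT⟩ : ∃ T : Fin (2 * m + 3) × Fin (2 * m + 3) → Finset (Fin (sectorCount n)), ∀ g, T g =
        (Finset.univ : Finset (Fin (sectorCount n))).filter (fun ι : Fin (sectorCount n) =>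
          ∃ k : Fin 2 → ℝ, (∀ i, |k i| ≤ Real.pi) ∧ |frameLevel μ K (WithLp.toLp 2 k)| ≤ klE0 / π ^ 2 * sectorWidth n ^ 2 ∧
            sectorIndex n (Complex.arg (⟨k 0, k 1⟩ : ℂ)) = (ι : ℕ) ∧ (∀ i, |k i - tg g i| ≤ m * Cc * sectorWidth n)) := ⟨_, fun _ => rfl⟩
    have hTcard : ∀ g, (((T g).card : ℕ) : ℝ) ≤ D₁ := fun g => by rw [hT]; exact hlast K A hA hAκ₁ μ hμ n (tg g)
    -- the pieces
    obtain ⟨Pc, hPc⟩ : ∃ Pc : (Fin 2 × Fin 3) × (Fin (2 * m + 3) × Fin (2 * m + 3)) → Finset (Fin (sectorCount n)), ∀ par, Pc par =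
        (Finset.univ : Finset (Fin (sectorCount n))).filter (fun ω : Fin (sectorCount n) => sh par.1 ω ∈ T par.2) := ⟨_, fun _ => rfl⟩
    -- (1) COVER
    have hcover : S ⊆ Finset.univ.biUnion Pc := by
      intro ω hω
      simp only [Finset.mem_biUnion, Finset.mem_univ, true_and]
      rw [hS, Finset.mem_filter, mem_bgmSectorSet] at hω
      obtain ⟨kf, hkF, hsum⟩ := hω.2
      -- the tuple with the last leg in place
      obtain ⟨Ω, hΩdef⟩ : ∃ Ω : Fin (m + 1) → SectorLeg (sectorCount n), Ω = Function.update ρ ℓ ((ω, s), c) := ⟨_, rfl⟩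
      have hΩℓ : Ω ℓ = ((ω, s), c) := by rw [hΩdef, Function.update_self]
      have hΩi : ∀ i, i ≠ ℓ → Ω i = ρ i := fun i hi => by rw [hΩdef, Function.update_of_ne hi]
      rw [← hΩdef] at hkF hsum
      -- signed centred momenta
      obtain ⟨qv, hqvdef⟩ : ∃ qv : Fin (m + 1) → Fin 2 → ℝ, ∀ i j, qv i j =
          if (Ω i).2 = 0 then torusCentredMomentum L (kf i).2 j else -torusCentredMomentum L (kf i).2 j := ⟨_, fun _ _ => rfl⟩
      have hqvfun : ∀ i, qv i = fun j =>
          if (Ω i).2 = 0 then torusCentredMomentum L (kf i).2 j else -torusCentredMomentum L (kf i).2 j := fun i => funext (hqvdef i)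
      have hqabs : ∀ i j, |qv i j| ≤ π := fun i j => by
        rw [hqvdef]; exact abs_signed_torusCentredMomentum_le_pi L (Ω i).2 (kf i).2 j
      obtain ⟨G, hG⟩ := exists_sum_signed_torusCentredMomentum_eq L (fun i => (Ω i).2) (fun i => (kf i).2) hsum
      have hGq : ∀ j, ∑ i, qv i j = 2 * π * (G j : ℝ) := fun j => by
        rw [← hG j]; exact Finset.sum_congr rfl fun i _ => hqvdef i j
      have hGabs : ∀ j, |G j| ≤ (m : ℤ) + 1 := abs_le_succ_of_sum_eq hqabs hGq
      have hG0 := hGabs 0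
      have hG1 := hGabs 1
      rw [abs_le] at hG0 hG1
      obtain ⟨g, hg⟩ : ∃ g : Fin (2 * m + 3) × Fin (2 * m + 3), Gof g = G := by
        refine ⟨(⟨(G 0 + (m + 1)).toNat, by omega⟩, ⟨(G 1 + (m + 1)).toNat, by omega⟩), funext fun i => ?_⟩
        have e0 : (((G 0 + (m + 1)).toNat : ℕ) : ℤ) = G 0 + (m + 1) := Int.toNat_of_nonneg (by omega)
        have e1 : (((G 1 + (m + 1)).toNat : ℕ) : ℤ) = G 1 + (m + 1) := Int.toNat_of_nonneg (by omega)
        rw [hGofdef]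
        split_ifs with hi
        · rw [hi]; simp only [e0]; ring
        · have hi1 : i = 1 := by fin_cases i <;> first | rfl | exact absurd rfl hi
          rw [hi1]; simp only [e1]; ring
      -- the last leg: thin shell and sharp index
      have hkℓ : klAnisoFamily L M β μ K klE0 n ω (kf ℓ) ≠ 0 := by have := hkF ℓ; rwa [hΩℓ] at this
      have hshell : |frameLevel μ K (WithLp.toLp 2 (qv ℓ))| ≤ klE0 / π ^ 2 * sectorWidth n ^ 2 := by
        rw [hqvfun ℓ, hΩℓ]; exact leg_thin_shell L M hkℓ c
      obtain ⟨e, d, hed⟩ := leg_sharp_index L M hkℓ c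
      have hidx : sectorIndex n (Complex.arg (⟨qv ℓ 0, qv ℓ 1⟩ : ℂ)) = (sh (e, d) ω : ℕ) := by
        rw [hshdef, hqvdef, hqvdef, hΩℓ]; exact hed
      -- the other legs: cells around the signed Fermi points
      have hcell : ∀ i, i ≠ ℓ → ∀ j, |qv i j - P i j| ≤ rc := by
        intro i hi j
        have hki : klAnisoFamily L M β μ K klE0 n (ρ i).1.1 (kf i) ≠ 0 := by have := hkF i; rwa [hΩi i hi] at this
        have hc := support_klAnisoFamily_cell B hA hA2 L M he0 β n hlo hhi (ρ i).1.1 (kf i) hki j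
        rw [← hrc] at hc
        rw [hqvdef, hP, hΩi i hi]
        split_ifs
        · exact hc
        · rw [← abs_neg]; convert hc using 2; ring
      -- the target
      have htarget : ∀ j, |qv ℓ j - tg g j| ≤ m * Cc * sectorWidth n := by
        intro j
        have hsplit : qv ℓ j + ∑ i ∈ Finset.univ.erase ℓ, qv i j = 2 * π * (G j : ℝ) := by
          have h := hGq j
          rwa [← Finset.add_sum_erase _ _ (Finset.mem_univ ℓ)] at h
        have hdiff : qv ℓ j - tg g j = ∑ i ∈ Finset.univ.erase ℓ, (P i j - qv i j) := by
          rw [htg, hg, Finset.sum_sub_distrib]; linarith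
        rw [hdiff]
        refine (Finset.abs_sum_le_sum_abs _ _).trans ?_
        calc ∑ i ∈ Finset.univ.erase ℓ, |P i j - qv i j| ≤ ∑ _i ∈ Finset.univ.erase ℓ, rc :=
              Finset.sum_le_sum fun i hi => by rw [abs_sub_comm]; exact hcell i (Finset.ne_of_mem_erase hi) j
          _ = m * rc := by rw [Finset.sum_const, Finset.card_erase_of_mem (Finset.mem_univ ℓ), Finset.card_univ, Fintype.card_fin]; simp
          _ ≤ m * (Cc * sectorWidth n) := mul_le_mul_of_nonneg_left hrcw (Nat.cast_nonneg m)
          _ = m * Cc * sectorWidth n := by ring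
      refine ⟨((e, d), g), ?_⟩
      rw [hPc, Finset.mem_filter]
      refine ⟨Finset.mem_univ _, ?_⟩
      rw [hT, Finset.mem_filter]
      exact ⟨Finset.mem_univ _, qv ℓ, hqabs ℓ, hshell, hidx, htarget⟩
    -- (2) PIECES: each injects into a last-leg set of §1
    have hpiece : ∀ par : (Fin 2 × Fin 3) × (Fin (2 * m + 3) × Fin (2 * m + 3)), (((Pc par).card : ℕ) : ℝ) ≤ D₁ := by
      intro par
      have hmaps : Set.MapsTo (sh par.1) ↑(Pc par) ↑(T par.2) := by
        intro ω hω
        rw [Finset.mem_coe, hPc, Finset.mem_filter] at hω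
        exact Finset.mem_coe.2 hω.2
      have hinj : Set.InjOn (sh par.1) ↑(Pc par) := fun ω _ ω' _ h => hsh_inj par.1 ω ω' h
      have hle : (Pc par).card ≤ (T par.2).card := Finset.card_le_card_of_injOn (sh par.1) hmaps hinj
      exact le_trans (by exact_mod_cast hle) (hTcard par.2)
    -- (3) ASSEMBLY
    have hpos : 0 < 2 * π / w₀ := by positivity
    calc ((S.card : ℕ) : ℝ) ≤ (((Finset.univ.biUnion Pc).card : ℕ) : ℝ) := by exact_mod_cast Finset.card_le_card hcover
      _ ≤ ∑ par, (((Pc par).card : ℕ) : ℝ) := by exact_mod_cast Finset.card_biUnion_le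
      _ ≤ ∑ _par : (Fin 2 × Fin 3) × (Fin (2 * m + 3) × Fin (2 * m + 3)), D₁ := Finset.sum_le_sum fun par _ => hpiece par
      _ = 6 * (2 * (m : ℝ) + 3) ^ 2 * D₁ := by
          simp only [Finset.sum_const, Finset.card_univ, Fintype.card_prod, Fintype.card_fin, nsmul_eq_mul]
          push_cast; ring
      _ ≤ 6 * (2 * (m : ℝ) + 3) ^ 2 * D₁ + 2 * π / w₀ := by linarith
  · -- the trivial case `w > w₀`
    have hlt : w₀ < sectorWidth n := lt_of_not_ge hwle
    have h6 : 0 ≤ 6 * (2 * (m : ℝ) + 3) ^ 2 * D₁ := by positivity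
    calc ((S.card : ℕ) : ℝ) ≤ 2 * π / sectorWidth n := htriv
      _ ≤ 2 * π / w₀ := div_le_div_of_nonneg_left (by positivity) hw₀pos hlt.le
      _ ≤ 6 * (2 * (m : ℝ) + 3) ^ 2 * D₁ + 2 * π / w₀ := by linarith

/-- **THE SAME IN THE KL REGIME, m-UNIFORM**: `D₀` and, for every `R` (`Gfr ≥ 0`), the thresholds `c₃, U₀ > 0` are fixed BEFORE the number of legs; for all
`0 < c ≤ c₃`, `0 < U ≤ U₀`, `klBetaMin ≤ β ≤ e^{c/U²}`, `μ ∈ [μ₁, μ₂]`, every frame with `FrameOK R U (nScales β) ν K`, every `m`, `L ≥ 1`, `M`, `n`, `ρ`, `ℓ`,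
`(s, ch)`: the last-leg count is `≤ D₀·(m + 2)³`. [cite: BenfattoGiulianiMastropietro2006, §2.8 (2.83), (2.89), App. A3] -/
theorem card_lastLeg_bgmSectorSet_klAniso_le_frameOK_uniform :
    ∀ μ₁ μ₂ : ℝ, -4 < μ₁ → μ₁ ≤ μ₂ → μ₂ < 0 → ∃ D₀ : ℝ, 0 < D₀ ∧ ∀ R : RenConsts, (∀ j, 0 ≤ R.Gfr j) →
      ∃ c₃ : ℝ, 0 < c₃ ∧ ∃ U₀ : ℝ, 0 < U₀ ∧ ∀ m : ℕ,
      ∀ c : ℝ, 0 < c → c ≤ c₃ → ∀ U : ℝ, 0 < U → U ≤ U₀ → ∀ β : ℝ, klBetaMin ≤ β → β ≤ Real.exp (c / U ^ 2) →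
      ∀ μ ∈ Set.Icc μ₁ μ₂, ∀ (ν : ℝ) (K : TrigPolyC4v), FrameOK R U (nScales β) ν K →
      ∀ (L M : ℕ) [NeZero L] (n : ℕ) (ρ : Fin (m + 1) → SectorLeg (sectorCount n)) (ℓ : Fin (m + 1)) (s ch : Fin 2),
      ((((Finset.univ : Finset (Fin (sectorCount n))).filter (fun ω : Fin (sectorCount n) =>
        Function.update ρ ℓ ((ω, s), ch) ∈ bgmSectorSet L M (klAnisoFamily L M β μ K klE0 n) (m + 1))).card : ℕ) : ℝ) ≤ D₀ * ((m : ℝ) + 2) ^ 3 := by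
  intro μ₁ μ₂ hμ₁ h12 hμ₂
  obtain ⟨κ, hκ, D₀, hD₀, h⟩ := card_lastLeg_bgmSectorSet_klAniso_le_frame_uniform μ₁ μ₂ hμ₁ h12 hμ₂
  refine ⟨D₀, hD₀, fun R hR => ?_⟩
  obtain ⟨c₃, hc₃, U₀, hU₀, hthr⟩ := frame_thresholds hR hκ
  refine ⟨c₃, hc₃, U₀, hU₀, ?_⟩
  intro m c hc hcle U hU hUle β hβmin hβc μ hμ ν K hK L M _ n ρ ℓ s ch
  exact h m K _ (fun p j hj => norm_iteratedFDeriv_frameShift_le_of_frameOK_regime hR hc.le hβmin hβc hK p hj)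
    (hthr c U hc.le hcle hU hUle) μ hμ L M β n ρ ℓ s ch

end Summit.HubbardSuperconductivity.HubbardSuperconductivity.Theorems.PerturbedFermiCurve

end
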